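import Mathlib.Algebra.Polynomial.Degree.Lemmas
import Mathlib.Algebra.Polynomial.Degree.SmallDegree
import Mathlib.Algebra.Polynomial.AlgebraMap
import Mathlib.Algebra.MvPolynomial.Equiv
import Mathlib.Algebra.MvPolynomial.Monad
import Mathlib.Algebra.MvPolynomial.Funext
import Mathlib.Tactic.LinearCombination
import HarnessLib

/-!
# Affine substitutions: coefficients of `p(a + bX)` and slicing bivariate polynomials

Elementary bookkeeping used when comparing a polynomial identity
`G(u₀ + c V₀, u₁ + c V₁) = λ · S(V₀, V₁)` coefficient by coefficient:

* `coeff_comp_C_add_C_mul_X` — the coefficients of `p.comp (C a + C b * X)`: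
  `[Xⁿ] p(a + bX) = ∑ⱼ pⱼ · bⁿ · a^{j-n} · (j choose n)`, with the three special cases actually
  used: the top coefficient `p_d · b^d` (`coeff_comp_affine_natDegree`), the next one
  `(p_e + (e+1) · a · p_{e+1}) · b^e` for `d = e + 1` (`coeff_comp_affine_of_natDegree_eq_succ`),
  and the pure scaling `[Xⁿ] p(bX) = pₙ bⁿ` (`coeff_comp_C_mul_X`).
* the slicing isomorphism `R[X₀, X₁] ≃ R[T][Y]`, `X₀ ↦ Y`, `X₁ ↦ T` (Mathlib's
  `(finSuccEquiv R 1).trans (mapAlgEquiv (uniqueAlgEquiv R (Fin 1)))`, used unnamed), writing a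
  bivariate polynomial as a polynomial in `X₀` with coefficients ("slices") polynomials in `X₁`:
  it commutes with coefficient maps (`finTwoSlice_map`), its iterated coefficients are those of
  `G` (`coeff_coeff_finTwoSlice`), and it transports the affine substitution
  `bind₁ (Xᵢ ↦ uᵢ + c Xᵢ)` to "compose the slices with `u₁ + cT`, then the whole with `u₀ + cY`"
  (`finTwoSlice_bind₁_affine`).

All statements are folklore polynomial algebra.
-/

noncomputable section

open Polynomial

namespace Literature.Algebra.Polynomial

/-! ### Coefficients of `p.comp (C a + C b * X)` -/

section OneVariable

variable {R : Type*} [CommRing R]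

/-- The monomials of `(C a + C b * X) ^ j`. [folklore] -/
theorem C_add_C_mul_X_pow_eq_sum (a b : R) (j : ℕ) :
    (C a + C b * X) ^ j =
      ∑ m ∈ Finset.range (j + 1), C (b ^ m * a ^ (j - m) * (j.choose m : R)) * X ^ m := by
  rw [add_comm, add_pow]
  refine Finset.sum_congr rfl fun m _ => ?_
  rw [mul_pow, ← C_pow, ← C_pow, ← C_eq_natCast, map_mul, map_mul]
  ring

/-- **Coefficients of an affine substitution**:
`[Xⁿ] p(a + bX) = ∑ⱼ pⱼ bⁿ a^{j-n} (j choose n)`. [folklore] -/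
theorem coeff_comp_C_add_C_mul_X (p : R[X]) (a b : R) (n : ℕ) :
    (p.comp (C a + C b * X)).coeff n =
      p.sum fun j pj => pj * (b ^ n * a ^ (j - n) * (j.choose n : R)) := by
  rw [comp_eq_sum_left, Polynomial.sum, Polynomial.sum, finsetSum_coeff]
  refine Finset.sum_congr rfl fun j _ => ?_
  rw [coeff_C_mul, C_add_C_mul_X_pow_eq_sum, finsetSum_coeff]
  congr 1
  rw [Finset.sum_eq_single n]
  · rw [coeff_C_mul_X_pow, if_pos rfl]
  · intro m _ hmn
    rw [coeff_C_mul_X_pow, if_neg (Ne.symm hmn)]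
  · intro hn
    rw [Finset.mem_range, not_lt] at hn
    rw [coeff_C_mul_X_pow, if_pos rfl, Nat.choose_eq_zero_of_lt (by omega), Nat.cast_zero,
      mul_zero]

/-- The same coefficient formula as a sum over `range N` for any `N > deg p`. [folklore] -/
theorem coeff_comp_C_add_C_mul_X_eq_sum_range (p : R[X]) (a b : R) (n : ℕ) {N : ℕ}
    (hN : p.natDegree < N) :
    (p.comp (C a + C b * X)).coeff n =
      ∑ j ∈ Finset.range N, p.coeff j * (b ^ n * a ^ (j - n) * (j.choose n : R)) := by
  rw [coeff_comp_C_add_C_mul_X]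
  exact Polynomial.sum_over_range' _ (fun j => by rw [zero_mul]) _ hN

/-- `deg p(a + bX) ≤ deg p`. [folklore] -/
theorem natDegree_comp_affine_le (p : R[X]) (a b : R) :
    (p.comp (C a + C b * X)).natDegree ≤ p.natDegree := by
  refine natDegree_comp_le.trans ?_
  have h : (C a + C b * X).natDegree ≤ 1 := by
    rw [add_comm]
    exact natDegree_linear_le
  calc p.natDegree * (C a + C b * X).natDegree ≤ p.natDegree * 1 :=
        Nat.mul_le_mul_left _ h
    _ = p.natDegree := mul_one _

/-- **Top coefficient**: `[X^d] p(a + bX) = p_d b^d` for `d = deg p`. [folklore] -/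
theorem coeff_comp_affine_natDegree (p : R[X]) (a b : R) :
    (p.comp (C a + C b * X)).coeff p.natDegree = p.coeff p.natDegree * b ^ p.natDegree := by
  rw [coeff_comp_C_add_C_mul_X_eq_sum_range p a b _ (Nat.lt_succ_self _), Finset.sum_range_succ,
    Finset.sum_eq_zero, zero_add]
  · simp
  · intro j hj
    rw [Finset.mem_range] at hj
    rw [Nat.choose_eq_zero_of_lt hj, Nat.cast_zero, mul_zero, mul_zero]

/-- **Second coefficient**: if `deg p = e + 1` then
`[X^e] p(a + bX) = (p_e + (e + 1) a p_{e+1}) b^e`. [folklore] -/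
theorem coeff_comp_affine_of_natDegree_eq_succ (p : R[X]) (a b : R) {e : ℕ}
    (he : p.natDegree = e + 1) :
    (p.comp (C a + C b * X)).coeff e =
      (p.coeff e + ((e + 1 : ℕ) : R) * a * p.coeff (e + 1)) * b ^ e := by
  have hN : p.natDegree < e + 2 := by omega
  rw [coeff_comp_C_add_C_mul_X_eq_sum_range p a b e hN, Finset.sum_range_succ,
    Finset.sum_range_succ, Finset.sum_eq_zero, zero_add]
  · rw [Nat.choose_self, Nat.sub_self, pow_zero, show e + 1 - e = 1 by omega, pow_one,
      Nat.choose_succ_self_right]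
    push_cast
    ring
  · intro j hj
    rw [Finset.mem_range] at hj
    rw [Nat.choose_eq_zero_of_lt hj, Nat.cast_zero, mul_zero, mul_zero]

/-- **Pure scaling**: `[Xⁿ] p(bX) = pₙ bⁿ`.  This is Mathlib's `Polynomial.comp_C_mul_X_coeff`
(explicit-argument form, kept under this name because Summits files `rw` with it; dedup-01316 —
prefer `Polynomial.comp_C_mul_X_coeff` in new code). [folklore] -/
theorem coeff_comp_C_mul_X (p : R[X]) (b : R) (n : ℕ) :
    (p.comp (C b * X)).coeff n = p.coeff n * b ^ n :=
  comp_C_mul_X_coeff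

end OneVariable

/-! ### Slicing `R[X₀, X₁]` as `R[T][Y]` -/

section Slice

variable (R : Type*) [CommRing R]

/-! The isomorphism `R[X₀, X₁] ≃ₐ[R] R[T][Y]` sending `X₀ ↦ Y` (the outer variable) and
`X₁ ↦ T` (the coefficient variable) is Mathlib's
`(MvPolynomial.finSuccEquiv R 1).trans (Polynomial.mapAlgEquiv (MvPolynomial.uniqueAlgEquiv R (Fin 1)))`;
we do not introduce a name for it and state its bookkeeping lemmas directly. -/

/-- `C r ↦ C (C r)` under the slicing isomorphism (`simp`-normal form). [folklore] -/
@[simp] theorem map_uniqueAlgEquiv_finSuccEquiv_C (r : R) :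
    Polynomial.map (MvPolynomial.uniqueAlgEquiv R (Fin 1) : MvPolynomial (Fin 1) R →+* Polynomial R)
      (MvPolynomial.finSuccEquiv R 1 (MvPolynomial.C r)) = Polynomial.C (Polynomial.C r) := by
  rw [MvPolynomial.finSuccEquiv_apply, MvPolynomial.eval₂Hom_C, RingHom.comp_apply, Polynomial.map_C]
  congr 1
  simp [MvPolynomial.uniqueAlgEquiv_apply]

/-- `X₀ ↦ Y` under the slicing isomorphism (`simp`-normal form). [folklore] -/
@[simp] theorem map_uniqueAlgEquiv_finSuccEquiv_X_zero :
    Polynomial.map (MvPolynomial.uniqueAlgEquiv R (Fin 1) : MvPolynomial (Fin 1) R →+* Polynomial R)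
      (MvPolynomial.finSuccEquiv R 1 (MvPolynomial.X 0)) = Polynomial.X := by
  rw [MvPolynomial.finSuccEquiv_X_zero, Polynomial.map_X]

/-- `X₁ ↦ C T` under the slicing isomorphism (`simp`-normal form). [folklore] -/
@[simp] theorem map_uniqueAlgEquiv_finSuccEquiv_X_one :
    Polynomial.map (MvPolynomial.uniqueAlgEquiv R (Fin 1) : MvPolynomial (Fin 1) R →+* Polynomial R)
      (MvPolynomial.finSuccEquiv R 1 (MvPolynomial.X 1)) = Polynomial.C Polynomial.X := by
  have h1 : (1 : Fin 2) = Fin.succ 0 := rfl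
  rw [h1, MvPolynomial.finSuccEquiv_X_succ, Polynomial.map_C]
  congr 1
  simp [MvPolynomial.uniqueAlgEquiv_apply]

/-- `X₀ ↦ Y` under the slicing isomorphism. [folklore] -/
theorem finTwoSlice_X_zero :
    ((MvPolynomial.finSuccEquiv R 1).trans
      (Polynomial.mapAlgEquiv (MvPolynomial.uniqueAlgEquiv R (Fin 1)))) (MvPolynomial.X 0) =
      Polynomial.X := by
  simp

/-- `X₁ ↦ C T` under the slicing isomorphism. [folklore] -/
theorem finTwoSlice_X_one :
    ((MvPolynomial.finSuccEquiv R 1).trans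
      (Polynomial.mapAlgEquiv (MvPolynomial.uniqueAlgEquiv R (Fin 1)))) (MvPolynomial.X 1) =
      Polynomial.C Polynomial.X := by
  simp

/-- `C r ↦ C (C r)` under the slicing isomorphism. [folklore] -/
theorem finTwoSlice_C (r : R) :
    ((MvPolynomial.finSuccEquiv R 1).trans
      (Polynomial.mapAlgEquiv (MvPolynomial.uniqueAlgEquiv R (Fin 1)))) (MvPolynomial.C r) =
      Polynomial.C (Polynomial.C r) := by
  simp

variable {R}

/-- The slicing isomorphism commutes with a change of coefficient ring. [folklore] -/
theorem finTwoSlice_map {S : Type*} [CommRing S] (f : R →+* S) (G : MvPolynomial (Fin 2) R) :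
    ((MvPolynomial.finSuccEquiv S 1).trans
      (Polynomial.mapAlgEquiv (MvPolynomial.uniqueAlgEquiv S (Fin 1)))) (MvPolynomial.map f G) =
      Polynomial.map (Polynomial.mapRingHom f)
        (((MvPolynomial.finSuccEquiv R 1).trans
          (Polynomial.mapAlgEquiv (MvPolynomial.uniqueAlgEquiv R (Fin 1)))) G) := by
  have h : (((MvPolynomial.finSuccEquiv S 1).trans
      (Polynomial.mapAlgEquiv (MvPolynomial.uniqueAlgEquiv S (Fin 1)))).toAlgHom.toRingHom.comp
        (MvPolynomial.map f)) =
      (Polynomial.mapRingHom (Polynomial.mapRingHom f)).comp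
        ((MvPolynomial.finSuccEquiv R 1).trans
          (Polynomial.mapAlgEquiv (MvPolynomial.uniqueAlgEquiv R (Fin 1)))).toAlgHom.toRingHom := by
    refine MvPolynomial.ringHom_ext (fun r => ?_) (fun i => ?_)
    · simp
    · fin_cases i <;> simp
  exact RingHom.congr_fun h G

/-- The coefficients of the slices are the coefficients of `G`:
`[Tⁿ] ([Yʲ] slice G) = [X₀ʲ X₁ⁿ] G`. [folklore] -/
theorem coeff_coeff_finTwoSlice (G : MvPolynomial (Fin 2) R) (j n : ℕ) :
    ((((MvPolynomial.finSuccEquiv R 1).trans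
      (Polynomial.mapAlgEquiv (MvPolynomial.uniqueAlgEquiv R (Fin 1)))) G).coeff j).coeff n =
      G.coeff (Finsupp.single 0 j + Finsupp.single 1 n) := by
  rw [AlgEquiv.trans_apply, Polynomial.coe_mapAlgEquiv, Polynomial.coeff_map]
  change (MvPolynomial.uniqueAlgEquiv R (Fin 1) _).coeff n = _
  rw [MvPolynomial.coeff_uniqueAlgEquiv, MvPolynomial.finSuccEquiv_coeff_coeff]
  congr 1
  ext i
  fin_cases i
  · simp
  · show (Finsupp.cons j (Finsupp.single default n) : Fin 2 →₀ ℕ) (Fin.succ 0) =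
      (Finsupp.single (0 : Fin 2) j + Finsupp.single 1 n : Fin 2 →₀ ℕ) (Fin.succ 0)
    rw [Finsupp.cons_succ]
    simp

/-- A polynomial whose only slice is the constant `γ` in degree `J` is `γ X₀^J`. [folklore] -/
theorem eq_C_mul_X_pow_of_finTwoSlice_eq (G : MvPolynomial (Fin 2) R) (γ : R) (J : ℕ)
    (h : ((MvPolynomial.finSuccEquiv R 1).trans
      (Polynomial.mapAlgEquiv (MvPolynomial.uniqueAlgEquiv R (Fin 1)))) G =
        Polynomial.C (Polynomial.C γ) * Polynomial.X ^ J) :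
    G = MvPolynomial.C γ * MvPolynomial.X 0 ^ J := by
  apply ((MvPolynomial.finSuccEquiv R 1).trans
    (Polynomial.mapAlgEquiv (MvPolynomial.uniqueAlgEquiv R (Fin 1)))).injective
  rw [h, map_mul, map_pow, finTwoSlice_C, finTwoSlice_X_zero]

/-! ### The affine substitution `Xᵢ ↦ uᵢ + c Xᵢ` and its slices

The substitution is `MvPolynomial.bind₁ (fun i => C (u i) + C c * X i)`; again we state its
properties without naming it. -/

/-- Evaluating the affine substitution at `x` evaluates `G` at `u + c x`. [folklore] -/
theorem eval_bind₁_affine (u : Fin 2 → R) (c : R) (G : MvPolynomial (Fin 2) R) (x : Fin 2 → R) :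
    MvPolynomial.eval x
      (MvPolynomial.bind₁ (fun i => MvPolynomial.C (u i) + MvPolynomial.C c * MvPolynomial.X i) G) =
      MvPolynomial.eval (fun i => u i + c * x i) G := by
  have h : (MvPolynomial.eval x).comp
      (MvPolynomial.bind₁ (fun i => MvPolynomial.C (u i) + MvPolynomial.C c * MvPolynomial.X i) :
        MvPolynomial (Fin 2) R →ₐ[R] MvPolynomial (Fin 2) R).toRingHom =
      MvPolynomial.eval (fun i => u i + c * x i) :=
    MvPolynomial.ringHom_ext (fun r => by simp) (fun i => by simp)
  exact RingHom.congr_fun h G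

/-- **Slices of an affine substitution.** Under the slicing isomorphism, substituting
`Xᵢ ↦ uᵢ + c Xᵢ` amounts to composing every slice with `u₁ + c T` and then the polynomial in `Y`
with `u₀ + c Y`. [folklore] -/
theorem finTwoSlice_bind₁_affine (u : Fin 2 → R) (c : R) (G : MvPolynomial (Fin 2) R) :
    ((MvPolynomial.finSuccEquiv R 1).trans
      (Polynomial.mapAlgEquiv (MvPolynomial.uniqueAlgEquiv R (Fin 1))))
      (MvPolynomial.bind₁ (fun i => MvPolynomial.C (u i) + MvPolynomial.C c * MvPolynomial.X i) G) =
      ((((MvPolynomial.finSuccEquiv R 1).trans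
          (Polynomial.mapAlgEquiv (MvPolynomial.uniqueAlgEquiv R (Fin 1)))) G).map
        (Polynomial.compRingHom (C (u 1) + C c * X))).comp (C (C (u 0)) + C (C c) * X) := by
  -- both sides are ring homomorphisms in `G`; compare them on `C r`, `X₀`, `X₁`
  let Θ : Polynomial (Polynomial R) →+* Polynomial (Polynomial R) :=
    (Polynomial.compRingHom (C (C (u 0)) + C (C c) * X)).comp
      (Polynomial.mapRingHom (Polynomial.compRingHom (C (u 1) + C c * X)))
  have h : ((MvPolynomial.finSuccEquiv R 1).trans
      (Polynomial.mapAlgEquiv (MvPolynomial.uniqueAlgEquiv R (Fin 1)))).toAlgHom.toRingHom.comp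
        (MvPolynomial.bind₁ (fun i => MvPolynomial.C (u i) + MvPolynomial.C c * MvPolynomial.X i) :
          MvPolynomial (Fin 2) R →ₐ[R] MvPolynomial (Fin 2) R).toRingHom =
      Θ.comp ((MvPolynomial.finSuccEquiv R 1).trans
        (Polynomial.mapAlgEquiv (MvPolynomial.uniqueAlgEquiv R (Fin 1)))).toAlgHom.toRingHom := by
    refine MvPolynomial.ringHom_ext (fun r => ?_) (fun i => ?_)
    · simp [Θ]
    · fin_cases i
      · simp [Θ]
      · simp [Θ]
  exact RingHom.congr_fun h G

/-- Over a field, the affine substitution with `c ≠ 0` is injective (it is an automorphism with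
inverse `Xᵢ ↦ c⁻¹ (Xᵢ - uᵢ)`). [folklore] -/
theorem bind₁_affine_injective {K : Type*} [Field K] (u : Fin 2 → K) {c : K} (hc : c ≠ 0) :
    Function.Injective
      (MvPolynomial.bind₁ (fun i => MvPolynomial.C (u i) + MvPolynomial.C c * MvPolynomial.X i) :
        MvPolynomial (Fin 2) K →ₐ[K] MvPolynomial (Fin 2) K) := by
  let ψ : MvPolynomial (Fin 2) K →ₐ[K] MvPolynomial (Fin 2) K :=
    MvPolynomial.bind₁ fun i => MvPolynomial.C c⁻¹ * (MvPolynomial.X i - MvPolynomial.C (u i))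
  have h : ψ.comp (MvPolynomial.bind₁
      (fun i => MvPolynomial.C (u i) + MvPolynomial.C c * MvPolynomial.X i)) = AlgHom.id K _ := by
    refine MvPolynomial.algHom_ext fun i => ?_
    simp only [AlgHom.comp_apply, MvPolynomial.bind₁_X_right, map_add, map_mul,
      MvPolynomial.bind₁_C_right, AlgHom.coe_id, id_eq, ψ]
    have hcc : MvPolynomial.C c * MvPolynomial.C c⁻¹ = (1 : MvPolynomial (Fin 2) K) := by
      rw [← map_mul, mul_inv_cancel₀ hc, map_one]
    linear_combination (MvPolynomial.X i - MvPolynomial.C (u i)) * hcc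
  intro G H hGH
  have := congrArg ψ hGH
  rwa [← AlgHom.comp_apply, ← AlgHom.comp_apply, h, AlgHom.id_apply, AlgHom.id_apply] at this

end Slice

end Literature.Algebra.Polynomial
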